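import Summits.QuantumFields.YangMills.Theorems.BalabanUVNodesN18CombStepRemainderLipschitz
import Summits.QuantumFields.YangMills.Theorems.BalabanUVNodesN18AvgUnitsTranslate
import HarnessLib

/-!
# BalabanUVNodes ∕ node N18 = NE5 — closure-ledger item (iii), comb step M4c, file (6c-α):
# THE LINEARISATION REMAINDER AT A TRANSLATED COARSE BOND DIFFERS FROM THE ONE AT `c` BY `O(radius × field variation)`

(Track A, DAG node N18 = `T4OutputRate.NE5`; cluster K4 «SpineRates», key item K3⁸ `SpineGivenEndpointR13SepCoPHV` (stmt-QuantumFields-27366);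
seat pub-ymgap-dag-n18-w3 g5, INTENT-6 = design step M4c of `COMB-STEP-DESIGN.md` ∕ `COMB-CHAIN-INDEX.md`.)

HONEST FRAMING.  Count-neutral kernel bookkeeping (`--supports stmt-QuantumFields-27366 --as helper`).  This is the gauge-free core of the
coarse-Lipschitz bound of the linearisation remainder `F_c[S,U₀,A] = (iξ)⁻¹log(Ū(S)(c)Ū(U₀)(c)⁻¹) − (η∕ξ)(Q₁A)(c)` (design step M4c, the cure of the
last C¹ side term of FILE 7 without `η_j`-decay): for ONE globally factorised small triple `S = (exp iηA)·U₀` and ANY coarse translation `e`,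
`‖F_{c+e} − F_c‖ ≤ ξ⁻¹·800000·ℓ²·(s+t)·(η·ε_A + 2t)`, where `ε_A` bounds the variation `A(b + Le) − A(b)` on the two-block bonds of `c` only —
(6a) `potRem_translate` moves `F_{c+e}` to the translated fields at `c`, the two-block locality of `Ū` and `Q₁` (UST `emlAvgU_congr₂`, g3's
`linAvg_congr₂`) cuts `A` and `A ∘ τ` off to the two blocks of `c` (so the variation hypothesis is needed only there), and (6b) ★★
`norm_potRem_sub_potRem_le` is the Lipschitz estimate (`‖U₀ ∘ τ − U₀‖ ≤ 2t` for free: both are within `t` of `1`, and `t = O(η_j²)` is the gain).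
The raw-letter transport version (pair-box axial gauge, `H`-errors, the `∇^ξ` assembly replacing the `2R∕ξ²` of (4d)) is file (6c-β).  Nothing of
Bałaban's analysis is asserted beyond the cited tree theorems; NE5 NOT printed ∕ NOT proved; N18 NOT discharged; finite tori — nothing about the
continuum ∕ OS ∕ mass gap; YM mass gap (Clay) NOT proved — R4 closes the conditional finite-𝕋⁴ rung `BalabanLadder.UV` only.

0 `def`, 0 `sorry`.  References: T. Bałaban, CMP **98** (1985) 17–51 [Balaban1985Averaging] (Prop. 3 (122)–(126) p.36, (62)–(63) p.28);
CMP **109** (1987) 249–301 [Balaban1987RG1] ((0.4) p.253, (1.12)–(1.13) p.262, (2.17) p.269); C. King, CMP **102** (1986) 649–677 [King1986] ((3.43)–(3.47) p.661).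
-/

noncomputable section

open scoped BigOperators Matrix.Norms.L2Operator
open NormedSpace

namespace YMDAG.N18.TransportOfRecord

open Complex (I)
open Literature.MathematicalPhysics.QuantumFieldTheory.Balaban1983to89
open Literature.MathematicalPhysics.QuantumFieldTheory.Balaban1983to89.T4Continuum
open Literature.MathematicalPhysics.QuantumFieldTheory.Balaban1983to89.BlockAveraging
open Literature.MathematicalPhysics.QuantumFieldTheory.Balaban1983to89.BlockAveragingEMLLinearised (linAvg)
open Literature.MathematicalPhysics.QuantumFieldTheory.Balaban1983to89.B12RegularSpaces111 (expI)
open Literature.MathematicalPhysics.QuantumFieldTheory.Balaban1983to89.MatrixLog (mlog)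
open Literature.MathematicalPhysics.QuantumFieldTheory.Balaban1983to89.Node00.W1 (avgUnits)
open Summit.QuantumFields.YangMills.Theorems.Prop8Chart (emlAvgU_congr₂)
open YMDAG.N18.AvgRemainderUnits (linAvg_congr₂)

variable {P : Params} {j : ℕ} {n : Type*} [Fintype n] [DecidableEq n] [Nonempty n]

/-- ★ **THE LINEARISATION REMAINDER AT THE TRANSLATED COARSE BOND**: for a globally factorised triple `S = (exp iηA)·U₀` with `|A| ≤ a`, `ηa ≤ 1∕2`,
`‖U₀ − 1‖ ≤ t` (`0 < t`) on all bonds, `384ℓ((2ηa + t + 2ηa·t) + t) ≤ 1`, `ξ > 0`, a coarse translation `e`, and a bound `ε_A` on the variation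
`‖A(b + Le) − A(b)‖` over the two-block bonds `b` of `c`:
`‖F_{c+e}[S,U₀,A] − F_c[S,U₀,A]‖ ≤ ξ⁻¹·800000·ℓ²·((2ηa + t + 2ηa·t) + t)·(η·ε_A + 2t)`, `F_c = (iξ)⁻¹log(Ū(S)(c)Ū(U₀)(c)⁻¹) − (η∕ξ)(Q₁A)(c)`.
[cite: Balaban1985Averaging, Prop. 3 (122)-(126) p.36, (62)-(63) p.28; Balaban1987RG1, (0.4) p.253, (1.12)-(1.13) p.262, (2.17) p.269; King1986, (3.43)-(3.47) p.661] -/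
theorem norm_potRem_translate_sub_potRem_le (hj : j + 1 ≤ P.m + P.K) (e : Site P (j + 1)) {U₀ S : GaugeField P j (Matrix n n ℂ)ˣ}
    {A : PBond P j → Matrix n n ℂ} {η ξ a t εA : ℝ} (hη : 0 ≤ η) (hξ : 0 < ξ) (hS : ∀ b, S b = expI η (A b) * U₀ b) (hA : ∀ b, ‖A b‖ ≤ a)
    (hηa : η * a ≤ 1 / 2) (ht0 : 0 < t) (hU : ∀ b, ‖((U₀ b : (Matrix n n ℂ)ˣ) : Matrix n n ℂ) - 1‖ ≤ t) (hεA : 0 ≤ εA) (c : PBond P (j + 1))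
    (hdA : ∀ b : PBond P j, (blockOf b.src = c.src ∨ blockOf b.src = c.tgt) → (blockOf b.tgt = c.src ∨ blockOf b.tgt = c.tgt) →
      ‖A (b.translate (Site.scale e)) - A b‖ ≤ εA)
    (hℓ : 384 * (((P.d + 2) * P.L : ℕ) : ℝ) * ((2 * (η * a) + t + 2 * (η * a) * t) + t) ≤ 1) :
    ‖((I * (ξ : ℂ))⁻¹ • mlog (((avgUnits S (c.translate e) : (Matrix n n ℂ)ˣ) : Matrix n n ℂ) *
            (((avgUnits U₀ (c.translate e))⁻¹ : (Matrix n n ℂ)ˣ) : Matrix n n ℂ)) - ((η / ξ : ℝ) : ℂ) • linAvg A (c.translate e)) -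
        ((I * (ξ : ℂ))⁻¹ • mlog (((avgUnits S c : (Matrix n n ℂ)ˣ) : Matrix n n ℂ) * (((avgUnits U₀ c)⁻¹ : (Matrix n n ℂ)ˣ) : Matrix n n ℂ)) -
          ((η / ξ : ℝ) : ℂ) • linAvg A c)‖ ≤
      ξ⁻¹ * (800000 * (((P.d + 2) * P.L : ℕ) : ℝ) ^ 2 * ((2 * (η * a) + t + 2 * (η * a) * t) + t) * (η * εA + 2 * t)) := by
  classical
  have ha0 : 0 ≤ a := (norm_nonneg _).trans (hA ⟨0, ⟨0, P.hd⟩⟩)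
  -- the two-block cut-offs of `A` and of `A ∘ τ_{Le}`, refactorised with the same `U₀` resp. `U₀ ∘ τ_{Le}`
  let χ : PBond P j → Prop := fun b => (blockOf b.src = c.src ∨ blockOf b.src = c.tgt) ∧ (blockOf b.tgt = c.src ∨ blockOf b.tgt = c.tgt)
  let A₁ : PBond P j → Matrix n n ℂ := fun b => if χ b then A b else 0
  let A₂ : PBond P j → Matrix n n ℂ := fun b => if χ b then A (b.translate (Site.scale e)) else 0
  let U₂ : GaugeField P j (Matrix n n ℂ)ˣ := U₀.translate (Site.scale e)
  let S₁ : GaugeField P j (Matrix n n ℂ)ˣ := fun b => expI η (A₁ b) * U₀ b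
  let S₂ : GaugeField P j (Matrix n n ℂ)ˣ := fun b => expI η (A₂ b) * U₂ b
  have hA₁ : ∀ b, ‖A₁ b‖ ≤ a := fun b => by
    by_cases hb : χ b
    · simp only [A₁, if_pos hb]; exact hA b
    · simp only [A₁, if_neg hb, norm_zero]; exact ha0
  have hA₂ : ∀ b, ‖A₂ b‖ ≤ a := fun b => by
    by_cases hb : χ b
    · simp only [A₂, if_pos hb]; exact hA _
    · simp only [A₂, if_neg hb, norm_zero]; exact ha0
  have hU₂ : ∀ b, ‖((U₂ b : (Matrix n n ℂ)ˣ) : Matrix n n ℂ) - 1‖ ≤ t := fun b => by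
    simp only [U₂, GaugeField.translate_apply]; exact hU _
  have hdU : ∀ b, ‖((U₂ b : (Matrix n n ℂ)ˣ) : Matrix n n ℂ) - ((U₀ b : (Matrix n n ℂ)ˣ) : Matrix n n ℂ)‖ ≤ 2 * t := fun b => by
    have : ((U₂ b : (Matrix n n ℂ)ˣ) : Matrix n n ℂ) - ((U₀ b : (Matrix n n ℂ)ˣ) : Matrix n n ℂ) =
        (((U₂ b : (Matrix n n ℂ)ˣ) : Matrix n n ℂ) - 1) - (((U₀ b : (Matrix n n ℂ)ˣ) : Matrix n n ℂ) - 1) := by abel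
    rw [this]
    exact (norm_sub_le _ _).trans (by linarith [hU₂ b, hU b])
  have hdA' : ∀ b, ‖A₂ b - A₁ b‖ ≤ εA := fun b => by
    by_cases hb : χ b
    · simp only [A₁, A₂, if_pos hb]; exact hdA b hb.1 hb.2
    · simp only [A₁, A₂, if_neg hb, sub_zero, norm_zero]; exact hεA
  -- (6b) ★★ for the cut-off triples
  have key := norm_potRem_sub_potRem_le hj (U₀ := U₀) (S := S₁) (U₀' := U₂) (S' := S₂) (A := A₁) (A' := A₂) hη hξ (fun _ => rfl) (fun _ => rfl)
    hA₁ hA₂ hηa ht0 hU hU₂ hεA (by positivity : (0 : ℝ) ≤ 2 * t) hdA' hdU hℓ c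
  -- two-block locality: the cut-off triples have the same `F_c` as the original resp. translated triple
  have hS₁ : avgUnits S₁ c = avgUnits S c := emlAvgU_congr₂ hj c fun b h1 h2 => by
    have hb : χ b := ⟨h1, h2⟩
    show expI η (A₁ b) * U₀ b = S b
    rw [hS b]; simp only [A₁, if_pos hb]
  have hA₁l : linAvg A₁ c = linAvg A c := linAvg_congr₂ hj c fun b h1 h2 => by
    have hb : χ b := ⟨h1, h2⟩
    simp only [A₁, if_pos hb]
  have hS₂ : avgUnits S₂ c = avgUnits (S.translate (Site.scale e)) c := emlAvgU_congr₂ hj c fun b h1 h2 => by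
    have hb : χ b := ⟨h1, h2⟩
    show expI η (A₂ b) * U₂ b = (S.translate (Site.scale e)) b
    rw [GaugeField.translate_apply, hS]
    simp only [A₂, U₂, if_pos hb, GaugeField.translate_apply]
  have hA₂l : linAvg A₂ c = linAvg (fun b => A (b.translate (Site.scale e))) c := linAvg_congr₂ hj c fun b h1 h2 => by
    have hb : χ b := ⟨h1, h2⟩
    simp only [A₂, if_pos hb]
  have hU₂l : avgUnits U₂ c = avgUnits (U₀.translate (Site.scale e)) c := rfl
  rw [← potRem_translate e S U₀ A η ξ c, ← hS₂, ← hA₂l, ← hU₂l, ← hS₁, ← hA₁l]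
  exact key

end YMDAG.N18.TransportOfRecord

end
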